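import Summits.NavierStokesRegularity.NavierStokesRegularity.Theorems.EulerZoomLiouvillePowerGaugeEulerLiouvilleBreatherWeakProfile

/-!
# Crux `EulerZoomLiouville.PowerGaugeEulerLiouville` (stmt-NavierStokesRegularity-19832), line `logtime-breathers` (T3, weak residue, PAST form):
# profile data of a weak log-time breather from LARGE-SCALE gauges only — `A`-growth and `E`-growth

Width seat `ns-ezl-w4` (g3; weak breather rigidity, past form, file L1).  A breather on a past sub-slab `τ < T₁` is handled by translating time by `T₁`;
the translated member is a whole-slab breather, is suitable weak and has a weak gradient, but only its LARGE-SCALE gauges (`a ≥ 1`) are controlled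
(`Q_a(0,0) + (T₁,0) ⊆ Q_{a'}(0,0)`, `a'² = a² + |T₁|`).  This file re-derives the two velocity-side profile bounds of `…BreatherWeakProfile` /
`BreatherRigidity.lintegral_ball_profile_le` from gauge hypotheses at radii `a ≥ 1` only:

* `BreatherWeak.lintegral_ball_profile_le_of_large` — `∫_{B_L}|V|² ≤ e^{5|c|}(e^{|c|})^{1−2ρ} c₀ · L^{1−2ρ}` for `L ≥ 1` (slice `τ = −1/2`, radius
  `a = e^{|c|}L ≥ 1`);
* `BreatherWeak.profile_gradient_growth_of_gaugeE_of_large` — `∫_{B_L}|G|²_F ≤ e^{6|c|}(e^{2|c|})^{1−ρ}c₀ · L^{1−ρ}` for `L ≥ 2` (verbatim the whole-slab proof,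
  which only uses `a = e^{2|c|}L ≥ 2`).

WHAT THIS IS NOT: not NS regularity, not the crux — data bricks for the PAST form of the weak breather-rigidity member; `--supports` stmt-19832. [folklore]
-/

noncomputable section

set_option linter.dupNamespace false

open MeasureTheory Set Filter Topology Metric Function TopologicalSpace
open scoped ENNReal NNReal RealInnerProductSpace ContDiff

namespace Summit.NavierStokesRegularity.NavierStokesRegularity.Theorems.PowerGaugeEulerLiouville

open Literature.Analysis Literature.Analysis.FunctionSpaces Literature.Analysis.FluidPDE

namespace BreatherWeak

variable {u : ℝ → EuclideanSpace ℝ (Fin 3) → EuclideanSpace ℝ (Fin 3)} {p : ℝ → EuclideanSpace ℝ (Fin 3) → ℝ}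
  {H : ℝ → EuclideanSpace ℝ (Fin 3) → EuclideanSpace ℝ (Fin 3) →L[ℝ] EuclideanSpace ℝ (Fin 3)}
  {c : ℝ} {V : EuclideanSpace ℝ (Fin 3) → EuclideanSpace ℝ (Fin 3)}

/-! ### `A`-growth from large scales -/

/-- **`A`-gauge at LARGE scales ⇒ profile energy growth for `L ≥ 1`.**  If `u(τ, y) = e^{cτ} V(e^{−cτ} y)` for `τ < 0` and
`a^{2ρ} A(a; 0; u) ≤ c₀` for all `a ≥ 1` (any real `ρ`), then `∫_{B_L}‖V‖² ≤ e^{5|c|} (e^{|c|})^{1−2ρ} c₀ · L^{1−2ρ}` for every `L ≥ 1`: the slice `τ = −1/2` is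
admissible for the radius `a = e^{|c|}L ≥ 1` (`−a² ≤ −1 < −1/2`), `B(L e^{−c/2}) ⊆ B(a)`, and `∫_{B_L}‖V‖² = e^{5c/2}∫_{B(Le^{−c/2})}‖u(−1/2)‖²`. [folklore] -/
theorem lintegral_ball_profile_le_of_large {ρ : ℝ} {c₀ : ℝ≥0}
    (hA : ∀ a : ℝ, 1 ≤ a → ENNReal.ofReal (a ^ (2 * ρ)) *
      cknA a (0 : ℝ × EuclideanSpace ℝ (Fin 3)) u ≤ (c₀ : ℝ≥0∞))
    (hbr : ∀ τ : ℝ, τ < 0 → ∀ y, u τ y = Real.exp (c * τ) • V (Real.exp (-(c * τ)) • y))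
    {L : ℝ} (hL : 1 ≤ L) :
    ∫⁻ x in ball (0 : EuclideanSpace ℝ (Fin 3)) L, ‖V x‖ₑ ^ 2 ≤
      ENNReal.ofReal (Real.exp (5 * |c|) * Real.exp |c| ^ (1 - 2 * ρ)) * (c₀ : ℝ≥0∞) * ENNReal.ofReal (L ^ (1 - 2 * ρ)) := by
  have hL0 : 0 < L := lt_of_lt_of_le one_pos hL
  set τ : ℝ := -(1 / 2) with hτdef
  have hτ0 : τ < 0 := by rw [hτdef]; norm_num
  have hcτ : |c * τ| ≤ |c| := by
    rw [abs_mul, hτdef, abs_neg, abs_of_pos (by norm_num : (0 : ℝ) < 1 / 2)]; nlinarith [abs_nonneg c]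
  -- the radius `a = e^{|c|} L ≥ 1`, admissible for the slice `τ = −1/2`
  set a : ℝ := Real.exp |c| * L with hadef
  have he1 : 1 ≤ Real.exp |c| := Real.one_le_exp (abs_nonneg c)
  have haL : L ≤ a := by rw [hadef]; nlinarith
  have ha1 : 1 ≤ a := hL.trans haL
  have ha0 : 0 < a := lt_of_lt_of_le one_pos ha1
  have hadm : -(a ^ 2) < τ := by
    rw [hτdef]; nlinarith
  have hτI : τ ∈ Ioo ((0 : ℝ × EuclideanSpace ℝ (Fin 3)).1 - a ^ 2) (0 : ℝ × EuclideanSpace ℝ (Fin 3)).1 := by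
    simp only [Prod.fst_zero, zero_sub, mem_Ioo]
    exact ⟨hadm, hτ0⟩
  -- the gauge on the slice
  have hslice : (ENNReal.ofReal a)⁻¹ * ∫⁻ x in ball (0 : EuclideanSpace ℝ (Fin 3)) a, ‖u τ x‖ₑ ^ 2 ≤
      cknA a (0 : ℝ × EuclideanSpace ℝ (Fin 3)) u := by
    unfold cknA
    exact le_iSup₂ (f := fun t (_ : t ∈ Ioo ((0 : ℝ × EuclideanSpace ℝ (Fin 3)).1 - a ^ 2)
        (0 : ℝ × EuclideanSpace ℝ (Fin 3)).1) =>
        (ENNReal.ofReal a)⁻¹ * ∫⁻ x in ball (0 : ℝ × EuclideanSpace ℝ (Fin 3)).2 a, ‖u t x‖ₑ ^ 2) τ hτI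
  set I : ℝ≥0∞ := ∫⁻ x in ball (0 : EuclideanSpace ℝ (Fin 3)) a, ‖u τ x‖ₑ ^ 2 with hI
  have hgauge : ENNReal.ofReal (a ^ (2 * ρ)) * ((ENNReal.ofReal a)⁻¹ * I) ≤ (c₀ : ℝ≥0∞) :=
    calc ENNReal.ofReal (a ^ (2 * ρ)) * ((ENNReal.ofReal a)⁻¹ * I)
        ≤ ENNReal.ofReal (a ^ (2 * ρ)) * cknA a (0 : ℝ × EuclideanSpace ℝ (Fin 3)) u := by gcongr
      _ ≤ (c₀ : ℝ≥0∞) := hA a ha1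
  have hKa : ENNReal.ofReal (a ^ (2 * ρ)) * (ENNReal.ofReal a)⁻¹ = ENNReal.ofReal (a ^ (2 * ρ - 1)) := by
    rw [← ENNReal.ofReal_inv_of_pos ha0, ← ENNReal.ofReal_mul (by positivity), Real.rpow_sub_one ha0.ne',
      div_eq_mul_inv]
  have hIle : I ≤ ENNReal.ofReal (a ^ (1 - 2 * ρ)) * (c₀ : ℝ≥0∞) := by
    have hunit : ENNReal.ofReal (a ^ (1 - 2 * ρ)) * ENNReal.ofReal (a ^ (2 * ρ - 1)) = 1 := by
      rw [← ENNReal.ofReal_mul (by positivity), ← Real.rpow_add ha0, show (1 - 2 * ρ) + (2 * ρ - 1) = 0 by ring,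
        Real.rpow_zero, ENNReal.ofReal_one]
    calc I = ENNReal.ofReal (a ^ (1 - 2 * ρ)) * (ENNReal.ofReal (a ^ (2 * ρ - 1)) * I) := by
          rw [← mul_assoc, hunit, one_mul]
      _ = ENNReal.ofReal (a ^ (1 - 2 * ρ)) * (ENNReal.ofReal (a ^ (2 * ρ)) * ((ENNReal.ofReal a)⁻¹ * I)) := by
          rw [← mul_assoc (ENNReal.ofReal (a ^ (2 * ρ))), hKa]
      _ ≤ ENNReal.ofReal (a ^ (1 - 2 * ρ)) * (c₀ : ℝ≥0∞) := by gcongr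
  -- the profile energy on `B_L` in terms of the slice: `∫_{B_L}|V|² = e^{-5cτ} ∫_{B(L e^{cτ})}|u τ|² ≤ e^{-5cτ} I`
  set J : ℝ≥0∞ := ∫⁻ x in ball (0 : EuclideanSpace ℝ (Fin 3)) L, ‖V x‖ₑ ^ 2 with hJ
  have hd : 0 < Real.exp (c * τ) := Real.exp_pos _
  have hJI : J ≤ ENNReal.ofReal (Real.exp (-(5 * (c * τ)))) * I := by
    -- `∫_{B(e^{cτ}L)} |u τ|² = e^{5cτ} ∫_{B_L} |V|²`
    have hfun : (fun x => ‖u τ x‖ₑ ^ 2) = fun x => ‖Real.exp (c * τ) • V (Real.exp (-(c * τ)) • x)‖ₑ ^ 2 := by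
      funext x; rw [hbr τ hτ0 x]
    have hsub : ball (0 : EuclideanSpace ℝ (Fin 3)) (Real.exp (c * τ) * L) ⊆ ball 0 a := by
      refine ball_subset_ball ?_
      have : Real.exp (c * τ) ≤ Real.exp |c| := by rw [Real.exp_le_exp]; linarith [le_abs_self (c * τ)]
      rw [hadef]; nlinarith
    have h1 : ∫⁻ x in ball (0 : EuclideanSpace ℝ (Fin 3)) (Real.exp (c * τ) * L), ‖u τ x‖ₑ ^ 2 =
        ENNReal.ofReal (Real.exp (5 * (c * τ))) * J := by
      have hrad : Real.exp (-(c * τ)) * (Real.exp (c * τ) * L) = L := by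
        rw [← mul_assoc, ← Real.exp_add, neg_add_cancel, Real.exp_zero, one_mul]
      rw [hfun, LogtimeBreather.lintegral_ball_enorm_sq_breatherSlice, hrad]
    have hE5 : ENNReal.ofReal (Real.exp (-(5 * (c * τ)))) * ENNReal.ofReal (Real.exp (5 * (c * τ))) = 1 := by
      rw [← ENNReal.ofReal_mul (Real.exp_pos _).le, ← Real.exp_add, neg_add_cancel, Real.exp_zero, ENNReal.ofReal_one]
    calc J = ENNReal.ofReal (Real.exp (-(5 * (c * τ)))) * (ENNReal.ofReal (Real.exp (5 * (c * τ))) * J) := by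
          rw [← mul_assoc, hE5, one_mul]
      _ = ENNReal.ofReal (Real.exp (-(5 * (c * τ)))) *
            ∫⁻ x in ball (0 : EuclideanSpace ℝ (Fin 3)) (Real.exp (c * τ) * L), ‖u τ x‖ₑ ^ 2 := by rw [h1]
      _ ≤ ENNReal.ofReal (Real.exp (-(5 * (c * τ)))) * I := mul_le_mul' le_rfl (lintegral_mono_set hsub)
  -- assemble
  have hexp : Real.exp (-(5 * (c * τ))) ≤ Real.exp (5 * |c|) := by
    rw [Real.exp_le_exp]; linarith [neg_abs_le (c * τ), le_abs_self (c * τ)]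
  have haρ : a ^ (1 - 2 * ρ) = Real.exp |c| ^ (1 - 2 * ρ) * L ^ (1 - 2 * ρ) := by
    rw [hadef, Real.mul_rpow (Real.exp_pos _).le hL0.le]
  calc J ≤ ENNReal.ofReal (Real.exp (-(5 * (c * τ)))) * I := hJI
    _ ≤ ENNReal.ofReal (Real.exp (5 * |c|)) * (ENNReal.ofReal (a ^ (1 - 2 * ρ)) * (c₀ : ℝ≥0∞)) :=
        mul_le_mul' (ENNReal.ofReal_le_ofReal hexp) hIle
    _ = ENNReal.ofReal (Real.exp (5 * |c|) * Real.exp |c| ^ (1 - 2 * ρ)) * (c₀ : ℝ≥0∞) * ENNReal.ofReal (L ^ (1 - 2 * ρ)) := by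
        rw [haρ, ENNReal.ofReal_mul (by positivity), ENNReal.ofReal_mul (by positivity)]
        ring

/-! ### `E`-growth of the profile gradient at large scales -/

/-- **THE `E`-GAUGE OF A WEAK BREATHER IN PROFILE VARIABLES from LARGE-SCALE gauge data only.**  As `profile_gradient_growth_of_gaugeE`, but the
gauge hypothesis `a^{ρ} E(a; 0; H) ≤ c₀` is required only for `a ≥ 1` (the proof only ever uses the radius `a = e^{2|c|}L ≥ 2`): the form available for a
TIME-TRANSLATED member, whose small-scale gauges are not controlled. [folklore] -/
theorem profile_gradient_growth_of_gaugeE_of_large {ρ : ℝ} {c₀ : ℝ≥0}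
    {G : EuclideanSpace ℝ (Fin 3) → EuclideanSpace ℝ (Fin 3) →L[ℝ] EuclideanSpace ℝ (Fin 3)}
    (hHm : AEStronglyMeasurable (uncurry H)
      (volume.restrict (Iio (0 : ℝ) ×ˢ (univ : Set (EuclideanSpace ℝ (Fin 3))))))
    (hHV : ∀ᵐ τ ∂((volume : Measure ℝ).restrict (Iio (0 : ℝ))),
      H τ =ᵐ[volume] fun x => G (Real.exp (-(c * τ)) • x))
    (hE : ∀ a : ℝ, 1 ≤ a →
      ENNReal.ofReal (a ^ ρ) * cknE a (0 : ℝ × EuclideanSpace ℝ (Fin 3)) H ≤ (c₀ : ℝ≥0∞)) :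
    ∀ L : ℝ, 2 ≤ L →
      ∫⁻ y in ball (0 : EuclideanSpace ℝ (Fin 3)) L, ENNReal.ofReal (frobeniusNormSq (G y)) ≤
        ENNReal.ofReal (Real.exp (6 * |c|) * Real.exp (2 * |c|) ^ (1 - ρ)) * (c₀ : ℝ≥0∞) *
          ENNReal.ofReal (L ^ (1 - ρ)) := by
  -- verbatim `profile_gradient_growth_of_gaugeE` (…BreatherWeakProfile) with `hE a ha0 ↦ hE a ha1`
  intro L hL
  have hfm : Measurable fun L : EuclideanSpace ℝ (Fin 3) →L[ℝ] EuclideanSpace ℝ (Fin 3) =>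
      ENNReal.ofReal (frobeniusNormSq L) :=
    (SereginZajaczkowski2007.continuous_frobeniusNormSq).measurable.ennreal_ofReal
  have hL0 : 0 < L := by linarith
  have he1 : 1 ≤ Real.exp (2 * |c|) := Real.one_le_exp (by positivity)
  -- ### the radius `a = e^{2|c|} L`
  set a : ℝ := Real.exp (2 * |c|) * L with ha
  have haL : L ≤ a := by rw [ha]; nlinarith
  have ha0 : 0 < a := by linarith
  have ha2 : (2 : ℝ) ≤ a ^ 2 := by nlinarith
  have ha1 : (1 : ℝ) ≤ a := by nlinarith
  -- ### (1) the gauge (LARGE scales only): `X = ∫∫_{Q_a} |H|²_F ≤ a^{1−ρ} c₀`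
  set X : ℝ≥0∞ := ∫⁻ q in parabolicCylinder a (0 : ℝ × EuclideanSpace ℝ (Fin 3)),
    ENNReal.ofReal (frobeniusNormSq (H q.1 q.2)) with hX
  have hXle : X ≤ ENNReal.ofReal (a ^ (1 - ρ)) * (c₀ : ℝ≥0∞) := by
    have h1 := hE a ha1
    unfold cknE at h1
    have hB0 : ENNReal.ofReal (a ^ ρ) ≠ 0 := by
      rw [ENNReal.ofReal_ne_zero_iff]; exact Real.rpow_pos_of_pos ha0 _
    have hA0 : ENNReal.ofReal a ≠ 0 := by rw [ENNReal.ofReal_ne_zero_iff]; exact ha0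
    have key : X = ENNReal.ofReal a * (ENNReal.ofReal (a ^ ρ))⁻¹ *
        (ENNReal.ofReal (a ^ ρ) * ((ENNReal.ofReal a)⁻¹ * X)) := by
      rw [← mul_assoc, mul_assoc (ENNReal.ofReal a), ENNReal.inv_mul_cancel hB0 ENNReal.ofReal_ne_top,
        mul_one, ← mul_assoc, ENNReal.mul_inv_cancel hA0 ENNReal.ofReal_ne_top, one_mul]
    calc X = _ := key
      _ ≤ ENNReal.ofReal a * (ENNReal.ofReal (a ^ ρ))⁻¹ * (c₀ : ℝ≥0∞) := by gcongr
      _ = ENNReal.ofReal (a ^ (1 - ρ)) * (c₀ : ℝ≥0∞) := by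
          rw [← ENNReal.ofReal_inv_of_pos (Real.rpow_pos_of_pos ha0 _), ← ENNReal.ofReal_mul ha0.le]
          congr 2
          rw [Real.rpow_sub ha0, Real.rpow_one, div_eq_mul_inv]
  -- ### (2) the window `(−2, −1) × B_a` inside `Q_a(0,0)`
  have hWsub : Ioo (-2 : ℝ) (-1) ×ˢ ball (0 : EuclideanSpace ℝ (Fin 3)) a ⊆
      parabolicCylinder a (0 : ℝ × EuclideanSpace ℝ (Fin 3)) := by
    intro q hq
    rw [mem_prod, mem_Ioo, mem_ball] at hq
    rw [mem_parabolicCylinder, Prod.fst_zero, Prod.snd_zero, zero_sub]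
    exact ⟨⟨by linarith [hq.1.1], by linarith [hq.1.2]⟩, hq.2⟩
  have hY : ∫⁻ q in Ioo (-2 : ℝ) (-1) ×ˢ ball (0 : EuclideanSpace ℝ (Fin 3)) a,
      ENNReal.ofReal (frobeniusNormSq (H q.1 q.2)) ≤ X :=
    lintegral_mono_set hWsub
  -- ### (3) Tonelli on the window
  have hHmW : AEMeasurable (fun q : ℝ × EuclideanSpace ℝ (Fin 3) =>
      ENNReal.ofReal (frobeniusNormSq (H q.1 q.2)))
      (((volume : Measure ℝ).restrict (Ioo (-2 : ℝ) (-1))).prod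
        ((volume : Measure (EuclideanSpace ℝ (Fin 3))).restrict (ball 0 a))) := by
    have hsub : Ioo (-2 : ℝ) (-1) ×ˢ ball (0 : EuclideanSpace ℝ (Fin 3)) a ⊆
        Iio (0 : ℝ) ×ˢ (univ : Set (EuclideanSpace ℝ (Fin 3))) :=
      prod_mono (fun t ht => by have := ht.2; rw [mem_Iio]; linarith) (subset_univ _)
    have := hfm.comp_aemeasurable (hHm.mono_measure (Measure.restrict_mono hsub le_rfl)).aemeasurable
    rwa [Measure.volume_eq_prod, ← Measure.prod_restrict] at this
  have hYeq : ∫⁻ q in Ioo (-2 : ℝ) (-1) ×ˢ ball (0 : EuclideanSpace ℝ (Fin 3)) a,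
        ENNReal.ofReal (frobeniusNormSq (H q.1 q.2)) =
      ∫⁻ τ in Ioo (-2 : ℝ) (-1), ∫⁻ x in ball (0 : EuclideanSpace ℝ (Fin 3)) a,
        ENNReal.ofReal (frobeniusNormSq (H τ x)) := by
    rw [Measure.volume_eq_prod, ← Measure.prod_restrict, lintegral_prod _ hHmW]
  -- ### (4) the a.e. lower bound on the slices of the window
  set J : ℝ≥0∞ := ∫⁻ y in ball (0 : EuclideanSpace ℝ (Fin 3)) L, ENNReal.ofReal (frobeniusNormSq (G y)) with hJ
  have hWT : Ioo (-2 : ℝ) (-1) ⊆ Iio 0 := fun t ht => by have := ht.2; rw [mem_Iio]; linarith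
  have hlow : ∀ᵐ τ ∂((volume : Measure ℝ).restrict (Ioo (-2 : ℝ) (-1))),
      ENNReal.ofReal (Real.exp (-(6 * |c|))) * J ≤
        ∫⁻ x in ball (0 : EuclideanSpace ℝ (Fin 3)) a, ENNReal.ofReal (frobeniusNormSq (H τ x)) := by
    filter_upwards [ae_restrict_of_ae_restrict_of_subset hWT hHV, ae_restrict_mem measurableSet_Ioo]
      with τ hτ hτW
    have hcτ : |c * τ| ≤ 2 * |c| := by
      rw [abs_mul]
      have : |τ| ≤ 2 := by rw [abs_le]; constructor <;> linarith [hτW.1, hτW.2]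
      nlinarith [abs_nonneg c]
    set d : ℝ := Real.exp (-(c * τ)) with hd
    have hd0 : 0 < d := Real.exp_pos _
    -- replace `H τ` by the dilated profile gradient on the ball
    have hcongr : ∫⁻ x in ball (0 : EuclideanSpace ℝ (Fin 3)) a, ENNReal.ofReal (frobeniusNormSq (H τ x)) =
        ∫⁻ x in ball (0 : EuclideanSpace ℝ (Fin 3)) a, ENNReal.ofReal (frobeniusNormSq (G (d • x))) :=
      lintegral_congr_ae (ae_restrict_of_ae (hτ.mono fun x hx => by simp only [hx, hd]))
    rw [hcongr]
    have hLa : L ≤ d * a := by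
      have h1 : Real.exp (-(2 * |c|)) ≤ d := by
        rw [hd, Real.exp_le_exp]; linarith [le_abs_self (c * τ), neg_abs_le (c * τ), hcτ]
      have h2 : Real.exp (-(2 * |c|)) * a = L := by
        rw [ha, ← mul_assoc, ← Real.exp_add, neg_add_cancel, Real.exp_zero, one_mul]
      rw [← h2]
      exact mul_le_mul_of_nonneg_right h1 ha0.le
    have hcoef : Real.exp (-(6 * |c|)) ≤ (d ^ 3)⁻¹ := by
      rw [hd, ← Real.exp_nat_mul, ← Real.exp_neg, Real.exp_le_exp]
      push_cast
      linarith [le_abs_self (c * τ), neg_abs_le (c * τ), hcτ]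
    calc ENNReal.ofReal (Real.exp (-(6 * |c|))) * J ≤ ENNReal.ofReal ((d ^ 3)⁻¹) * J :=
          mul_le_mul' (ENNReal.ofReal_le_ofReal hcoef) le_rfl
      _ ≤ _ := BreatherRigidity.lintegral_ball_frobeniusNormSq_dilate_ge hd0 G hLa
  -- ### (5) integrate the lower bound over the window (length `1`)
  have hvolW : volume (Ioo (-2 : ℝ) (-1)) = 1 := by
    rw [Real.volume_Ioo, show (-1 : ℝ) - -2 = 1 by ring, ENNReal.ofReal_one]
  have hJle : ENNReal.ofReal (Real.exp (-(6 * |c|))) * J ≤ X :=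
    calc ENNReal.ofReal (Real.exp (-(6 * |c|))) * J
        = ∫⁻ _ in Ioo (-2 : ℝ) (-1), ENNReal.ofReal (Real.exp (-(6 * |c|))) * J := by
          rw [setLIntegral_const, hvolW, mul_one]
      _ ≤ ∫⁻ τ in Ioo (-2 : ℝ) (-1), ∫⁻ x in ball (0 : EuclideanSpace ℝ (Fin 3)) a,
            ENNReal.ofReal (frobeniusNormSq (H τ x)) := lintegral_mono_ae hlow
      _ = _ := hYeq.symm
      _ ≤ X := hY
  -- ### (6) assemble
  have haρ : a ^ (1 - ρ) = Real.exp (2 * |c|) ^ (1 - ρ) * L ^ (1 - ρ) := by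
    rw [ha, Real.mul_rpow (Real.exp_pos _).le hL0.le]
  have hunit : ENNReal.ofReal (Real.exp (6 * |c|)) * ENNReal.ofReal (Real.exp (-(6 * |c|))) = 1 := by
    rw [← ENNReal.ofReal_mul (Real.exp_pos _).le, ← Real.exp_add, add_neg_cancel, Real.exp_zero, ENNReal.ofReal_one]
  calc J = ENNReal.ofReal (Real.exp (6 * |c|)) * (ENNReal.ofReal (Real.exp (-(6 * |c|))) * J) := by
        rw [← mul_assoc, hunit, one_mul]
    _ ≤ ENNReal.ofReal (Real.exp (6 * |c|)) * X := by gcongr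
    _ ≤ ENNReal.ofReal (Real.exp (6 * |c|)) * (ENNReal.ofReal (a ^ (1 - ρ)) * (c₀ : ℝ≥0∞)) := by gcongr
    _ = ENNReal.ofReal (Real.exp (6 * |c|) * Real.exp (2 * |c|) ^ (1 - ρ)) * (c₀ : ℝ≥0∞) *
          ENNReal.ofReal (L ^ (1 - ρ)) := by
        rw [haρ, ENNReal.ofReal_mul (by positivity), ENNReal.ofReal_mul (by positivity)]
        ring

end BreatherWeak

end Summit.NavierStokesRegularity.NavierStokesRegularity.Theorems.PowerGaugeEulerLiouville

end
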